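import Literature.Analysis.FluidPDE.PassiveScalarDiagForcedSteadyTest
import Literature.Analysis.FluidPDE.PassiveScalarDiagGradNorm
import Literature.Analysis.FluidPDE.PassiveScalarEnergyProofs
import HarnessLib

/-!
# The Fourier–Galerkin energy argument for weak passive scalars with constant diagonal
# diffusion, I: mode-by-mode energy identities and the summed right-hand side

Analysis/FluidPDE proof-support file (everything proved), first of the files establishing the
class-wide ENERGY EQUALITY for `Torus.IsWeakScalarTransportDiagForcedOn T a κ u s θ₀ θ`
(`∂ₜθ + u·∇θ = κ ∑ᵢ aᵢ ∂ᵢ∂ᵢθ + s` on `T^d × [0,T)`, bounded drift; `PassiveScalarDiagEnergyEquality`).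
The method is a Fourier–Galerkin argument run on an ARBITRARY weak solution (no approximation
scheme, no spatial mollification): with the cosine / sine modes `Cₖ = Re e_{-k}`, `Sₖ = Im e_{-k}`
(`Torus.reTrigPoly {-k} 1`, `Torus.reTrigPoly {-k} (-i)`) and the pairings `Aₖ(t) = ∫ θ(t) Cₖ = Re θ̂(t)(k)`,
`Bₖ(t) = ∫ θ(t) Sₖ = Im θ̂(t)(k)`,

* each pairing is absolutely continuous with the derivative predicted by the equation
  (`PassiveScalarDiagForcedSteadyTest.ae_integral_mul_eq`), so by the product rule for a.e.
  primitives `Aₖ(t)² + Bₖ(t)² = Aₖ(0)² + Bₖ(0)² + 2∫_{(0,t]} (Φ(Cₖ) Aₖ + Φ(Sₖ) Bₖ)`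
  (`IsWeakScalarTransportDiagForcedOn.ae_mode_energy_eq`), `Φ(g) = ∫ θ(⟪u,∇g⟫ + κ∑ᵢaᵢ∂ᵢ∂ᵢg) + ∫ s g`;
* **single modes are eigenfunctions of the diagonal operator**,
  `∑ᵢ aᵢ ∂ᵢ∂ᵢ Re(e_m c) = -4π² Q_a(m) Re(e_m c)`, `Q_a(m) = ∑ᵢ aᵢ mᵢ²` (`Torus.diagSymbol`);
* at a fixed time, the sum over the frequency ball `|k| ≤ N` of `Φ(Cₖ) Aₖ + Φ(Sₖ) Bₖ` is
  `∫ θ ⟪u, ∇P_N θ⟫ - 4π²κ ∑_{|k|≤N} Q_a(k)|θ̂(k)|² + ∫ s P_N θ`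
  (`Torus.galerkin_sum_rhs_eq`; `P_N = Torus.scalarTruncate N`, via
  `Torus.gradient_scalarTruncate_eq_sum_re_im`, `Torus.reTrigPoly_eq_sum_re_im`).

The assembly into the truncated energy identity is `PassiveScalarDiagGalerkinIdentity`.
This is the Galerkin energy computation of Robinson–Rodrigo–Sadowski 2016, §4.1–4.2 (there for
the Galerkin approximations of Navier–Stokes), applied to the truncations of a given weak solution,
in the role played by mollification in Bonicatto–Ciampa–Crippa 2024, proof of Thm. 3.3, (3.1).

## Mathlib / tree search

Tree: `TorusScalarTrigPoly` (`reTrigPoly`, `scalarTruncate`, `re/im_mFourierCoeff_ofReal`,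
`sq_norm_mFourierCoeff_ofReal`, `gradient_scalarTruncate_eq_sum_re_im`, `partialDeriv_reTrigPoly`),
`PassiveScalarDiagForcedClass` / `…SteadyTest` (class API, steady tests), `PassiveScalarDiagGradNorm`
(`diagSymbol`), `Literature.Analysis.FluidPDE.sq_const_add_setIntegral_eq` (`PassiveScalarEnergyMollified`).
`lean search 'galerkin_sum|ae_mode_energy'`: nothing. Mathlib: no Galerkin / energy estimates for PDE.

## References

* J. C. Robinson, J. L. Rodrigo, W. Sadowski, *The three-dimensional Navier–Stokes equations*
  (CUP 2016), §4.1 (Galerkin truncations `P_n`, Lemma 4.1), §4.2 (energy estimate, (4.20)).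
  [`RobinsonRodrigoSadowski2016`]
* P. Bonicatto, G. Ciampa, G. Crippa, J. Evol. Equ. 24 (2024), Paper No. 1, Thm. 3.3 and its
  proof, (3.1)–(3.4). [`BonicattoCiampaCrippa2023`]
* L. Grafakos, *Classical Fourier Analysis*, 3rd ed. (2014), Prop. 3.1.2 (10), Prop. 3.2.7 (3).
  [`Grafakos2014`]
-/

noncomputable section

open _root_.MeasureTheory _root_.Set _root_.Filter _root_.Function _root_.TopologicalSpace
open scoped ENNReal NNReal InnerProductSpace ContDiff Topology
open Literature.Analysis.FunctionSpaces.Torus Literature.Analysis.FunctionSpaces UnitAddTorus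

namespace Literature.Analysis.FluidPDE

variable {d : Type*} [Fintype d] [DecidableEq d]

/-! ## One-mode calculus for the diagonal operator -/

/-- **Single modes are eigenfunctions of the diagonal operator**:
`∑ᵢ aᵢ ∂ᵢ∂ᵢ (Re (e_m c)) = -4π² Q_a(m) Re (e_m c)`, `Q_a(m) = ∑ᵢ aᵢ mᵢ²`
(`∂ⱼ ↦ 2πi kⱼ`, Grafakos 2014, Prop. 3.1.2 (10)). [folklore] -/
private theorem diag_reTrigPoly_singleton (a : d → ℝ) (m : d → ℤ) (c : (d → ℤ) → ℂ) (x : UnitAddTorus d) :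
    ∑ i, a i * partialDeriv i (partialDeriv i (reTrigPoly {m} c)) x =
      -(4 * Real.pi ^ 2 * Torus.diagSymbol a m) * reTrigPoly {m} c x := by
  have h1 : ∀ i, partialDeriv i (partialDeriv i (reTrigPoly {m} c)) x =
      -(4 * Real.pi ^ 2 * (m i : ℝ) ^ 2) * reTrigPoly {m} c x := by
    intro i
    rw [show partialDeriv i (reTrigPoly {m} c) = reTrigPoly {m} (fun k => (2 * Real.pi * Complex.I * (k i)) • c k)
      from funext (partialDeriv_reTrigPoly {m} c i), partialDeriv_reTrigPoly, reTrigPoly_singleton_apply,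
      reTrigPoly_singleton_apply]
    have key : (2 * Real.pi * Complex.I * (m i)) • ((2 * Real.pi * Complex.I * (m i)) • c m) =
        (((-(4 * Real.pi ^ 2 * (m i : ℝ) ^ 2)) : ℝ) : ℂ) * c m := by
      simp only [smul_eq_mul]
      push_cast
      linear_combination (2 * (Real.pi : ℂ) * (m i : ℂ)) ^ 2 * c m * Complex.I_mul_I
    rw [key, ← mul_assoc, mul_comm (mFourier m x) _, mul_assoc, Complex.re_ofReal_mul]
  simp_rw [h1]
  rw [Torus.diagSymbol, Finset.mul_sum, ← Finset.sum_neg_distrib, Finset.sum_mul]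
  refine Finset.sum_congr rfl fun i _ => ?_
  ring

/-! ## The product rule for a.e. primitives -/

/-- **Product rule for an a.e. primitive with datum**: if `U(t) = c + ∫_{(0,t]} F` for a.e.
`t ∈ (0,T)` with `F ∈ L¹(0,T)`, then `U(t)² = c² + 2 ∫_{(0,t]} F U` for a.e. `t ∈ (0,T)`
(`Literature.Analysis.FluidPDE.sq_const_add_setIntegral_eq`). [folklore] -/
private theorem ae_sq_eq_of_ae_eq_add_setIntegral {T c : ℝ} {U F : ℝ → ℝ} (hF : IntegrableOn F (Ioo 0 T) volume)
    (hU : ∀ᵐ t ∂(volume.restrict (Ioo 0 T)), U t = c + ∫ τ in Ioc 0 t, F τ) :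
    ∀ᵐ t ∂(volume.restrict (Ioo 0 T)), U t ^ 2 = c ^ 2 + 2 * ∫ τ in Ioc 0 t, F τ * U τ := by
  have hU' : ∀ᵐ τ ∂(volume : Measure ℝ), τ ∈ Ioo 0 T → U τ = c + ∫ r in Ioc 0 τ, F r :=
    (ae_restrict_iff' measurableSet_Ioo).1 hU
  filter_upwards [hU, ae_restrict_mem measurableSet_Ioo] with t ht htT
  have hsub : Ioc 0 t ⊆ Ioo 0 T := Ioc_subset_Ioo_right htT.2
  rw [ht, sq_const_add_setIntegral_eq (hF.mono_set hsub)]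
  congr 1
  congr 1
  refine setIntegral_congr_ae measurableSet_Ioc ?_
  filter_upwards [hU'] with τ hτ hτI
  rw [hτ (hsub hτI)]

namespace Torus

/-! ## Identification of the summed right-hand side at a fixed time -/

section Slice

variable {δ σ : UnitAddTorus d → ℝ} {v : UnitAddTorus d → EuclideanSpace ℝ d}

omit [DecidableEq d] in
/-- Integrability of `δ ⟪v, G⟫` for a slice with `δ, ‖v‖δ ∈ L¹` and continuous `G`. [cite: DiPernaLions1989, §II.1 (12)–(14)] -/
theorem integrable_mul_inner_of_norm_mul (hδ : Integrable δ volume) (hv : AEStronglyMeasurable v volume)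
    (hvδ : Integrable (fun x => ‖v x‖ * δ x) volume) {G : UnitAddTorus d → EuclideanSpace ℝ d}
    (hG : Continuous G) : Integrable (fun x => δ x * ⟪v x, G x⟫_ℝ) volume := by
  obtain ⟨M, hM⟩ := exists_forall_norm_le_of_continuous hG
  refine (hvδ.norm.const_mul M).mono' (hδ.aestronglyMeasurable.mul (hv.inner hG.aestronglyMeasurable))
    (Eventually.of_forall fun x => ?_)
  rw [norm_mul, Real.norm_eq_abs, Real.norm_eq_abs, norm_mul, norm_norm, Real.norm_eq_abs]
  calc |δ x| * |⟪v x, G x⟫_ℝ| ≤ |δ x| * (‖v x‖ * M) :=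
        mul_le_mul_of_nonneg_left ((abs_real_inner_le_norm _ _).trans
          (mul_le_mul_of_nonneg_left (hM x) (norm_nonneg _))) (abs_nonneg _)
    _ = M * (‖v x‖ * |δ x|) := by ring

/-- **The transport part of the summed Galerkin right-hand side**: with `Aₖ = Re δ̂(k)`,
`Bₖ = Im δ̂(k)`, `∑_{|k|≤N} (Aₖ ∫ δ⟪v, ∇Cₖ⟫ + Bₖ ∫ δ⟪v, ∇Sₖ⟫) = ∫ δ ⟪v, ∇P_N δ⟫`
(`∇P_N δ = ∑ (Aₖ ∇Cₖ + Bₖ ∇Sₖ)`, `Torus.gradient_scalarTruncate_eq_sum_re_im`). [cite: RobinsonRodrigoSadowski2016, §4.1 (Fourier–Galerkin truncation)] -/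
theorem galerkin_sum_transport_eq (hδ : Integrable δ volume) (hv : AEStronglyMeasurable v volume)
    (hvδ : Integrable (fun x => ‖v x‖ * δ x) volume) (N : ℕ) :
    ∑ k ∈ freqBall N,
      ((∫ x, δ x * reTrigPoly {-k} (fun _ => (1 : ℂ)) x) *
          (∫ x, δ x * ⟪v x, gradient (reTrigPoly {-k} (fun _ => (1 : ℂ))) x⟫_ℝ) +
        (∫ x, δ x * reTrigPoly {-k} (fun _ => -Complex.I) x) *
          (∫ x, δ x * ⟪v x, gradient (reTrigPoly {-k} (fun _ => -Complex.I)) x⟫_ℝ)) =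
      ∫ x, δ x * ⟪v x, gradient (scalarTruncate N δ) x⟫_ℝ := by
  have hA : ∀ k, ∫ x, δ x * reTrigPoly {-k} (fun _ => (1 : ℂ)) x = (mFourierCoeff (fun x => (δ x : ℂ)) k).re :=
    fun k => (re_mFourierCoeff_ofReal hδ k).symm
  have hB : ∀ k, ∫ x, δ x * reTrigPoly {-k} (fun _ => -Complex.I) x = (mFourierCoeff (fun x => (δ x : ℂ)) k).im :=
    fun k => (im_mFourierCoeff_ofReal hδ k).symm
  have hIc : ∀ k, Integrable (fun x => δ x * ⟪v x, gradient (reTrigPoly {-k} (fun _ => (1 : ℂ))) x⟫_ℝ) volume :=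
    fun k => integrable_mul_inner_of_norm_mul hδ hv hvδ (isSmooth_reTrigPoly _ _).gradient.continuous
  have hIs : ∀ k, Integrable (fun x => δ x * ⟪v x, gradient (reTrigPoly {-k} (fun _ => -Complex.I)) x⟫_ℝ) volume :=
    fun k => integrable_mul_inner_of_norm_mul hδ hv hvδ (isSmooth_reTrigPoly _ _).gradient.continuous
  have hpt : ∀ x, δ x * ⟪v x, gradient (scalarTruncate N δ) x⟫_ℝ =
      ∑ k ∈ freqBall N, ((mFourierCoeff (fun x => (δ x : ℂ)) k).re *
          (δ x * ⟪v x, gradient (reTrigPoly {-k} (fun _ => (1 : ℂ))) x⟫_ℝ) +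
        (mFourierCoeff (fun x => (δ x : ℂ)) k).im *
          (δ x * ⟪v x, gradient (reTrigPoly {-k} (fun _ => -Complex.I)) x⟫_ℝ)) := by
    intro x
    rw [gradient_scalarTruncate_eq_sum_re_im, inner_sum, Finset.mul_sum]
    refine Finset.sum_congr rfl fun k _ => ?_
    rw [inner_add_right, real_inner_smul_right, real_inner_smul_right]
    ring
  simp_rw [hpt]
  rw [integral_finsetSum]
  · refine Finset.sum_congr rfl fun k _ => ?_
    rw [integral_add ((hIc k).const_mul _) ((hIs k).const_mul _), integral_const_mul, integral_const_mul,
      hA k, hB k]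
  · intro k _
    exact ((hIc k).const_mul _).add ((hIs k).const_mul _)

/-- **The diffusion part of the summed Galerkin right-hand side**:
`∑_{|k|≤N} (Aₖ ∫ δ (∑ᵢ aᵢ∂ᵢ∂ᵢ Cₖ) + Bₖ ∫ δ (∑ᵢ aᵢ∂ᵢ∂ᵢ Sₖ)) = -4π² ∑_{|k|≤N} Q_a(k) |δ̂(k)|²`
(single modes are eigenfunctions, `|δ̂(k)|² = Aₖ² + Bₖ²`). [cite: RobinsonRodrigoSadowski2016, §4.1 (Fourier–Galerkin truncation)] -/
theorem galerkin_sum_diffusion_eq (hδ : Integrable δ volume) (a : d → ℝ) (N : ℕ) :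
    ∑ k ∈ freqBall N,
      ((∫ x, δ x * reTrigPoly {-k} (fun _ => (1 : ℂ)) x) *
          (∫ x, δ x * ∑ i, a i * partialDeriv i (partialDeriv i (reTrigPoly {-k} (fun _ => (1 : ℂ)))) x) +
        (∫ x, δ x * reTrigPoly {-k} (fun _ => -Complex.I) x) *
          (∫ x, δ x * ∑ i, a i * partialDeriv i (partialDeriv i (reTrigPoly {-k} (fun _ => -Complex.I))) x)) =
      -(4 * Real.pi ^ 2 * ∑ k ∈ freqBall N,
        Torus.diagSymbol a k * ‖mFourierCoeff (fun x => (δ x : ℂ)) k‖ ^ 2) := by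
  rw [Finset.mul_sum, ← Finset.sum_neg_distrib]
  refine Finset.sum_congr rfl fun k _ => ?_
  have hD : ∀ c : (d → ℤ) → ℂ, ∫ x, δ x * ∑ i, a i * partialDeriv i (partialDeriv i (reTrigPoly {-k} c)) x =
      -(4 * Real.pi ^ 2 * Torus.diagSymbol a k) * ∫ x, δ x * reTrigPoly {-k} c x := by
    intro c
    rw [← integral_const_mul]
    refine integral_congr_ae (Eventually.of_forall fun x => ?_)
    dsimp only
    rw [diag_reTrigPoly_singleton, Torus.diagSymbol_neg]
    ring
  rw [hD, hD, sq_norm_mFourierCoeff_ofReal hδ k]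
  ring

/-- **The source part of the summed Galerkin right-hand side**:
`∑_{|k|≤N} (Aₖ ∫ σ Cₖ + Bₖ ∫ σ Sₖ) = ∫ σ P_N δ` (`P_N δ = ∑ (Aₖ Cₖ + Bₖ Sₖ)`). [cite: RobinsonRodrigoSadowski2016, §4.1 (Fourier–Galerkin truncation)] -/
theorem galerkin_sum_source_eq (hδ : Integrable δ volume) (hσ : Integrable σ volume) (N : ℕ) :
    ∑ k ∈ freqBall N,
      ((∫ x, δ x * reTrigPoly {-k} (fun _ => (1 : ℂ)) x) * (∫ x, σ x * reTrigPoly {-k} (fun _ => (1 : ℂ)) x) +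
        (∫ x, δ x * reTrigPoly {-k} (fun _ => -Complex.I) x) *
          (∫ x, σ x * reTrigPoly {-k} (fun _ => -Complex.I) x)) =
      ∫ x, σ x * scalarTruncate N δ x := by
  have hA : ∀ k, ∫ x, δ x * reTrigPoly {-k} (fun _ => (1 : ℂ)) x = (mFourierCoeff (fun x => (δ x : ℂ)) k).re :=
    fun k => (re_mFourierCoeff_ofReal hδ k).symm
  have hB : ∀ k, ∫ x, δ x * reTrigPoly {-k} (fun _ => -Complex.I) x = (mFourierCoeff (fun x => (δ x : ℂ)) k).im :=
    fun k => (im_mFourierCoeff_ofReal hδ k).symm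
  have hI : ∀ (c : (d → ℤ) → ℂ) (k : d → ℤ), Integrable (fun x => σ x * reTrigPoly {-k} c x) volume := by
    intro c k
    obtain ⟨M, hM⟩ := exists_forall_norm_le_of_continuous (continuous_reTrigPoly ({-k} : Finset (d → ℤ)) c)
    exact hσ.mul_bdd (continuous_reTrigPoly _ _).aestronglyMeasurable (Eventually.of_forall fun x => hM x)
  have hpt : ∀ x, σ x * scalarTruncate N δ x =
      ∑ k ∈ freqBall N, ((mFourierCoeff (fun x => (δ x : ℂ)) k).re * (σ x * reTrigPoly {-k} (fun _ => (1 : ℂ)) x) +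
        (mFourierCoeff (fun x => (δ x : ℂ)) k).im * (σ x * reTrigPoly {-k} (fun _ => -Complex.I) x)) := by
    intro x
    rw [scalarTruncate, reTrigPoly_eq_sum_re_im, Finset.mul_sum]
    refine Finset.sum_congr rfl fun k _ => ?_
    ring
  simp_rw [hpt]
  rw [integral_finsetSum]
  · refine Finset.sum_congr rfl fun k _ => ?_
    rw [integral_add ((hI _ k).const_mul _) ((hI _ k).const_mul _), integral_const_mul, integral_const_mul,
      hA k, hB k]
  · intro k _
    exact ((hI _ k).const_mul _).add ((hI _ k).const_mul _)

/-- **The summed Galerkin right-hand side at a fixed time**: for an integrable slice `δ` with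
`‖v‖δ ∈ L¹`, an integrable source slice `σ`, and the steady-test right-hand sides
`Φ(g) = ∫ δ (⟪v, ∇g⟫ + κ ∑ᵢ aᵢ ∂ᵢ∂ᵢ g) + ∫ σ g`,
`∑_{|k|≤N} (Φ(Cₖ) Aₖ + Φ(Sₖ) Bₖ) = ∫ δ ⟪v, ∇P_N δ⟫ - 4π²κ ∑_{|k|≤N} Q_a(k)|δ̂(k)|² + ∫ σ P_N δ`.
[cite: RobinsonRodrigoSadowski2016, §4.1 (Fourier–Galerkin truncation)] -/
theorem galerkin_sum_rhs_eq (hδ : Integrable δ volume) (hv : AEStronglyMeasurable v volume)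
    (hvδ : Integrable (fun x => ‖v x‖ * δ x) volume) (hσ : Integrable σ volume) (a : d → ℝ) (κ : ℝ) (N : ℕ) :
    ∑ k ∈ freqBall N,
      (((∫ x, δ x * (⟪v x, gradient (reTrigPoly {-k} (fun _ => (1 : ℂ))) x⟫_ℝ +
          κ * ∑ i, a i * partialDeriv i (partialDeriv i (reTrigPoly {-k} (fun _ => (1 : ℂ)))) x)) +
          ∫ x, σ x * reTrigPoly {-k} (fun _ => (1 : ℂ)) x) * (∫ x, δ x * reTrigPoly {-k} (fun _ => (1 : ℂ)) x) +
        ((∫ x, δ x * (⟪v x, gradient (reTrigPoly {-k} (fun _ => -Complex.I)) x⟫_ℝ +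
          κ * ∑ i, a i * partialDeriv i (partialDeriv i (reTrigPoly {-k} (fun _ => -Complex.I))) x)) +
          ∫ x, σ x * reTrigPoly {-k} (fun _ => -Complex.I) x) * (∫ x, δ x * reTrigPoly {-k} (fun _ => -Complex.I) x)) =
      (∫ x, δ x * ⟪v x, gradient (scalarTruncate N δ) x⟫_ℝ) -
        κ * (4 * Real.pi ^ 2 * ∑ k ∈ freqBall N,
          Torus.diagSymbol a k * ‖mFourierCoeff (fun x => (δ x : ℂ)) k‖ ^ 2) +
        ∫ x, σ x * scalarTruncate N δ x := by
  -- split each `Φ` into transport, diffusion and source parts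
  have hsplit : ∀ {g : UnitAddTorus d → ℝ}, IsSmooth g →
      ∫ x, δ x * (⟪v x, gradient g x⟫_ℝ + κ * ∑ i, a i * partialDeriv i (partialDeriv i g) x) =
        (∫ x, δ x * ⟪v x, gradient g x⟫_ℝ) + κ * ∫ x, δ x * ∑ i, a i * partialDeriv i (partialDeriv i g) x := by
    intro g hg
    have hc : Continuous fun x => ∑ i, a i * partialDeriv i (partialDeriv i g) x :=
      continuous_finsetSum _ fun i _ => continuous_const.mul ((hg.partialDeriv i).partialDeriv i).continuous
    obtain ⟨M, hM⟩ := exists_forall_norm_le_of_continuous hc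
    have hI2 : Integrable (fun x => δ x * ∑ i, a i * partialDeriv i (partialDeriv i g) x) volume :=
      hδ.mul_bdd hc.aestronglyMeasurable (Eventually.of_forall fun x => hM x)
    rw [← integral_const_mul, ← integral_add (integrable_mul_inner_of_norm_mul hδ hv hvδ hg.gradient.continuous)
      (hI2.const_mul κ)]
    exact integral_congr_ae (Eventually.of_forall fun x => by ring)
  calc _ = ∑ k ∈ freqBall N,
        (((∫ x, δ x * reTrigPoly {-k} (fun _ => (1 : ℂ)) x) *
            (∫ x, δ x * ⟪v x, gradient (reTrigPoly {-k} (fun _ => (1 : ℂ))) x⟫_ℝ) +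
          (∫ x, δ x * reTrigPoly {-k} (fun _ => -Complex.I) x) *
            (∫ x, δ x * ⟪v x, gradient (reTrigPoly {-k} (fun _ => -Complex.I)) x⟫_ℝ)) +
        κ * ((∫ x, δ x * reTrigPoly {-k} (fun _ => (1 : ℂ)) x) *
            (∫ x, δ x * ∑ i, a i * partialDeriv i (partialDeriv i (reTrigPoly {-k} (fun _ => (1 : ℂ)))) x) +
          (∫ x, δ x * reTrigPoly {-k} (fun _ => -Complex.I) x) *
            (∫ x, δ x * ∑ i, a i * partialDeriv i (partialDeriv i (reTrigPoly {-k} (fun _ => -Complex.I))) x)) +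
        ((∫ x, δ x * reTrigPoly {-k} (fun _ => (1 : ℂ)) x) * (∫ x, σ x * reTrigPoly {-k} (fun _ => (1 : ℂ)) x) +
          (∫ x, δ x * reTrigPoly {-k} (fun _ => -Complex.I) x) *
            (∫ x, σ x * reTrigPoly {-k} (fun _ => -Complex.I) x))) := by
        refine Finset.sum_congr rfl fun k _ => ?_
        rw [hsplit (isSmooth_reTrigPoly _ _), hsplit (isSmooth_reTrigPoly _ _)]
        ring
    _ = _ := by
        rw [Finset.sum_add_distrib, Finset.sum_add_distrib, ← Finset.mul_sum, galerkin_sum_transport_eq hδ hv hvδ N,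
          galerkin_sum_diffusion_eq hδ a N, galerkin_sum_source_eq hδ hσ N]
        ring

end Slice

namespace IsWeakScalarTransportDiagForcedOn

variable {T κ : ℝ} {a : d → ℝ} {u : ℝ → UnitAddTorus d → EuclideanSpace ℝ d} {s : ℝ → UnitAddTorus d → ℝ}
  {θ₀ : UnitAddTorus d → ℝ} {θ : ℝ → UnitAddTorus d → ℝ}

/-! ## Per-mode energy identities -/

/-- The pairing of the solution with a continuous steady field is essentially bounded on `(0,T)`:
`|∫ θ(τ) c| ≤ K` for a.e. `τ` (`θ ∈ L^∞_t L²_x ⊂ L^∞_t L¹_x`). [cite: DiPernaLions1989, §II.1 (12)–(14)] -/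
theorem exists_ae_abs_integral_mul_le (h : IsWeakScalarTransportDiagForcedOn T a κ u s θ₀ θ)
    {c : UnitAddTorus d → ℝ} (hc : Continuous c) :
    ∃ K : ℝ, ∀ᵐ τ ∂(volume.restrict (Ioo 0 T)), |∫ x, θ τ x * c x| ≤ K := by
  obtain ⟨M, hM⟩ := exists_forall_norm_le_of_continuous hc
  obtain ⟨C₁, hC₁⟩ := h.exists_eLpNorm_le
  refine ⟨M * C₁, ?_⟩
  filter_upwards [hC₁, h.ae_memLp_two] with τ hτ hm
  have hI : Integrable (θ τ) volume := hm.integrable one_le_two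
  have h0 : 0 ≤ M := (norm_nonneg _).trans (hM 0)
  calc |∫ x, θ τ x * c x| ≤ ∫ x, M * |θ τ x| := by
        rw [← Real.norm_eq_abs]
        refine norm_integral_le_of_norm_le (hI.abs.const_mul M) (Eventually.of_forall fun x => ?_)
        rw [norm_mul, Real.norm_eq_abs, mul_comm]
        exact mul_le_mul_of_nonneg_right (hM x) (abs_nonneg _)
    _ = M * ∫ x, |θ τ x| := integral_const_mul _ _
    _ ≤ M * C₁ := mul_le_mul_of_nonneg_left (integral_abs_le_of_eLpNorm_le hm hτ) h0

/-- `τ ↦ F(τ) · ∫ θ(τ) c` is integrable on `(0,T)` for `F ∈ L¹(0,T)` and continuous steady `c`.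
[cite: DiPernaLions1989, §II.1 (12)–(14)] -/
theorem integrableOn_mul_pairing (h : IsWeakScalarTransportDiagForcedOn T a κ u s θ₀ θ)
    {F : ℝ → ℝ} (hF : IntegrableOn F (Ioo 0 T) volume) {c : UnitAddTorus d → ℝ} (hc : Continuous c) :
    IntegrableOn (fun τ => F τ * ∫ x, θ τ x * c x) (Ioo 0 T) volume := by
  obtain ⟨K, hK⟩ := h.exists_ae_abs_integral_mul_le hc
  exact Integrable.mul_bdd hF (h.integrable_mul_continuous hc).integral_prod_left.aestronglyMeasurable
    (hK.mono fun τ hτ => by rwa [Real.norm_eq_abs])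

/-- **Per-mode energy identity.** For every frequency `k` and a.e. `t ∈ (0,T)`, with the cosine
and sine modes `Cₖ = Re e_{-k}`, `Sₖ = Im e_{-k}` and the pairings `Aₖ(t) = ∫ θ(t) Cₖ`,
`Bₖ(t) = ∫ θ(t) Sₖ` (the real and imaginary parts of `θ̂(t)(k)`):
`Aₖ(t)² + Bₖ(t)² = Aₖ(0)² + Bₖ(0)² + 2 ∫_{(0,t]} (Φᶜₖ Aₖ + Φˢₖ Bₖ)`, where `Φᶜₖ`, `Φˢₖ` are the
right-hand sides of the steady-test identities for `Cₖ`, `Sₖ` (the Galerkin system tested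
against its own solution, mode by mode; Robinson–Rodrigo–Sadowski 2016, §4.2).
[cite: RobinsonRodrigoSadowski2016, §4.2 (Galerkin energy estimate)] -/
theorem ae_mode_energy_eq (h : IsWeakScalarTransportDiagForcedOn T a κ u s θ₀ θ)
    {C S : UnitAddTorus d → ℝ} (hC : IsSmooth C) (hS : IsSmooth S) :
    ∀ᵐ t ∂(volume.restrict (Ioo 0 T)),
      (∫ x, θ t x * C x) ^ 2 + (∫ x, θ t x * S x) ^ 2 =
      (∫ x, θ₀ x * C x) ^ 2 + (∫ x, θ₀ x * S x) ^ 2 +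
      2 * ∫ τ in Ioc 0 t,
        (((∫ x, θ τ x * (⟪u τ x, gradient C x⟫_ℝ + κ * ∑ i, a i * partialDeriv i (partialDeriv i C) x)) +
          ∫ x, s τ x * C x) * (∫ x, θ τ x * C x) +
        ((∫ x, θ τ x * (⟪u τ x, gradient S x⟫_ℝ + κ * ∑ i, a i * partialDeriv i (partialDeriv i S) x)) +
          ∫ x, s τ x * S x) * (∫ x, θ τ x * S x)) := by
  have hFc : IntegrableOn (fun τ => (∫ x, θ τ x *
      (⟪u τ x, gradient C x⟫_ℝ + κ * ∑ i, a i * partialDeriv i (partialDeriv i C) x)) +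
      ∫ x, s τ x * C x) (Ioo 0 T) volume :=
    (h.integrable_mul_steadyFlux hC).integral_prod_left.add
      (h.integrable_source_mul_continuous hC.continuous).integral_prod_left
  have hFs : IntegrableOn (fun τ => (∫ x, θ τ x *
      (⟪u τ x, gradient S x⟫_ℝ + κ * ∑ i, a i * partialDeriv i (partialDeriv i S) x)) +
      ∫ x, s τ x * S x) (Ioo 0 T) volume :=
    (h.integrable_mul_steadyFlux hS).integral_prod_left.add
      (h.integrable_source_mul_continuous hS.continuous).integral_prod_left
  have h1 := ae_sq_eq_of_ae_eq_add_setIntegral hFc (h.ae_integral_mul_eq hC)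
  have h2 := ae_sq_eq_of_ae_eq_add_setIntegral hFs (h.ae_integral_mul_eq hS)
  have hP1 := h.integrableOn_mul_pairing hFc hC.continuous
  have hP2 := h.integrableOn_mul_pairing hFs hS.continuous
  filter_upwards [h1, h2, ae_restrict_mem measurableSet_Ioo] with t ht1 ht2 htT
  have hsub : Ioc 0 t ⊆ Ioo 0 T := Ioc_subset_Ioo_right htT.2
  rw [ht1, ht2, integral_add (hP1.mono_set hsub) (hP2.mono_set hsub)]
  ring

end IsWeakScalarTransportDiagForcedOn

end Torus

end Literature.Analysis.FluidPDE

end
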